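import Literature.MathematicalPhysics.QuantumLattice.DWaveNodalShellCount
import Mathlib.Analysis.SpecificLimits.Basic
import HarnessLib

/-!
# The `T²`-law of the nodal `d`-wave band on the discrete torus: `Σ_k e^{-βE_k} ≤ C (L²/β² + 1)/Δ`

Topic `Literature/MathematicalPhysics/QuantumLattice`; finite-volume companion of `DWaveNodalThermalLaw`
(continuum `∫ e^{-βE} ≤ C/(Δβ²)`), obtained from the nodal level count
`DWaveNodalShellCount.exists_card_nodalShell_le`
(`#{k ∈ (ℤ/Lℤ)² : (ε_L(k) - μ)² + (Δ d(k))² < t²} ≤ C (Lt + 1)²/Δ`) by an Abel (dyadic-in-energy)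
summation instead of the layer-cake formula:

* `sq_add_one_le_four_mul_two_pow` — `(n + 1)² ≤ 4 · 2ⁿ`;
* `exp_neg_mul_sq_add_one_le` — `e^{-n} (n + 1)² ≤ 4 (2/e)ⁿ` (a summable majorant, `2 < e`);
* `exists_sum_exp_neg_mul_bdgEnergy_le` — **for `[μ₁, μ₂] ⊂ (-4, 0)` and `Δ₀ > 0` there is `C ≥ 0`
  with `Σ_{k ∈ (ℤ/Lℤ)²} exp(-β E_L(k)) ≤ C (L²/β² + 1)/Δ`** for all `μ ∈ [μ₁, μ₂]`, `0 < Δ ≤ Δ₀`,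
  `β > 0` and every side `L ≥ 1`, where `E_L(k) = √((torusBand L k - μ)² + (Δ · dWaveGap k)²)`.
  Proof: group the momenta by `n = ⌊β E_L(k)⌋`; on the `n`-th group the weight is `≤ e^{-n}` and the
  group has at most `#{E_L < (n+1)/β} ≤ C₀ (L(n+1)/β + 1)²/Δ` elements; sum the majorant
  `8 C₀ (L²/β² + 1) (2/e)ⁿ / Δ` over `n`.

Per unit volume this is the `T²` Boltzmann weight of the four Dirac cones plus the `O(1/(ΔL²))`
contribution of the `O(1/Δ)` momenta below the first level — the form in which the nodal phase space
enters finite-volume free-energy and trace estimates that must be uniform in `L`, in `β` and in a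
regulated gap. Everything is proved; no definitions. [folklore]

## Sources

Folklore (nodal thermodynamics of `d`-wave superconductors: N. E. Hussey, Adv. Phys. 51 (2002) 1685, §2);
momentum grid as in S. Friedli, Y. Velenik, *Statistical Mechanics of Lattice Systems* (2017), §10.4.
-/

noncomputable section

open Real Set
open Literature.Probability.LatticeModels

namespace Literature.MathematicalPhysics.QuantumLattice

/-- `(n + 1)² ≤ 4 · 2ⁿ`. [folklore] -/
theorem sq_add_one_le_four_mul_two_pow (n : ℕ) : ((n : ℝ) + 1) ^ 2 ≤ 4 * 2 ^ n := by
  induction n with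
  | zero => norm_num
  | succ n ih =>
    have h2 : (n : ℝ) + 1 ≤ 2 ^ n := by exact_mod_cast Nat.lt_two_pow_self
    have h1 : (1 : ℝ) ≤ 2 ^ n := one_le_pow₀ (by norm_num)
    push_cast
    rw [show (2 : ℝ) ^ (n + 1) = 2 ^ n * 2 from pow_succ 2 n]
    nlinarith

/-- The summable majorant `e^{-n} (n + 1)² ≤ 4 (2/e)ⁿ`. [folklore] -/
theorem exp_neg_mul_sq_add_one_le (n : ℕ) :
    Real.exp (-(n : ℝ)) * ((n : ℝ) + 1) ^ 2 ≤ 4 * (2 / Real.exp 1) ^ n := by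
  have h := sq_add_one_le_four_mul_two_pow n
  have he : Real.exp (-(n : ℝ)) = (Real.exp 1)⁻¹ ^ n := by
    rw [← Real.exp_neg, ← Real.exp_nat_mul]
    congr 1; ring
  have he0 : 0 ≤ (Real.exp 1)⁻¹ ^ n := pow_nonneg (inv_nonneg.2 (Real.exp_pos 1).le) n
  calc Real.exp (-(n : ℝ)) * ((n : ℝ) + 1) ^ 2 = (Real.exp 1)⁻¹ ^ n * ((n : ℝ) + 1) ^ 2 := by rw [he]
    _ ≤ (Real.exp 1)⁻¹ ^ n * (4 * 2 ^ n) := mul_le_mul_of_nonneg_left h he0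
    _ = 4 * (2 / Real.exp 1) ^ n := by rw [div_eq_mul_inv, mul_pow]; ring

/-- **The `T²`-law of the nodal `d`-wave band on the discrete torus.** For `[μ₁, μ₂] ⊂ (-4, 0)` and
`Δ₀ > 0` there is `C ≥ 0` such that for all `μ ∈ [μ₁, μ₂]`, `0 < Δ ≤ Δ₀`, `β > 0` and every side
`L ≥ 1`, `Σ_{k ∈ (ℤ/Lℤ)²} exp(-β √((ε_L(k) - μ)² + (Δ d(k))²)) ≤ C (L²/β² + 1)/Δ`. [folklore] -/
theorem exists_sum_exp_neg_mul_bdgEnergy_le {μ₁ μ₂ Δ₀ : ℝ} (hμ₁ : -4 < μ₁) (hμ₂ : μ₂ < 0)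
    (hΔ₀ : 0 < Δ₀) :
    ∃ C : ℝ, 0 ≤ C ∧ ∀ μ ∈ Icc μ₁ μ₂, ∀ Δ ∈ Ioc (0 : ℝ) Δ₀, ∀ β : ℝ, 0 < β → ∀ (L : ℕ) [NeZero L],
      ∑ k : TorusSite 2 L,
        Real.exp (-(β * Real.sqrt ((torusBand L k - μ) ^ 2 + (Δ * dWaveGap k) ^ 2))) ≤
        C * ((L : ℝ) ^ 2 / β ^ 2 + 1) / Δ := by
  classical
  obtain ⟨C₀, hC₀, hcard⟩ := exists_card_nodalShell_le hμ₁ hμ₂ hΔ₀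
  -- the geometric majorant
  set q : ℝ := 2 / Real.exp 1 with hq
  have he2 : 2 < Real.exp 1 := by
    have := Real.add_one_lt_exp (one_ne_zero)
    linarith
  have hq0 : 0 ≤ q := by positivity
  have hq1 : q < 1 := by rw [hq, div_lt_one (Real.exp_pos 1)]; exact he2
  have hqs : Summable fun n : ℕ => q ^ n := summable_geometric_of_lt_one hq0 hq1
  have hqt : ∑' n : ℕ, q ^ n = (1 - q)⁻¹ := tsum_geometric_of_lt_one hq0 hq1
  have hB0 : 0 ≤ (1 - q)⁻¹ := inv_nonneg.2 (by linarith)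
  refine ⟨8 * C₀ * (1 - q)⁻¹, by positivity, fun μ hμ Δ hΔ β hβ L _ => ?_⟩
  have hΔ0 : 0 < Δ := hΔ.1
  -- notation
  set F : TorusSite 2 L → ℝ := fun k => (torusBand L k - μ) ^ 2 + (Δ * dWaveGap k) ^ 2 with hF
  set E : TorusSite 2 L → ℝ := fun k => Real.sqrt (F k) with hE
  set nk : TorusSite 2 L → ℕ := fun k => ⌊β * E k⌋₊ with hnk
  have hE0 : ∀ k, 0 ≤ β * E k := fun k => mul_nonneg hβ.le (Real.sqrt_nonneg _)
  -- step 1: the weight on the `n`-th group is at most `e^{-n}`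
  have hstep1 : ∀ k, Real.exp (-(β * E k)) ≤ Real.exp (-(nk k : ℝ)) := fun k => by
    rw [Real.exp_le_exp, neg_le_neg_iff]
    exact Nat.floor_le (hE0 k)
  -- step 2: the `n`-th group is contained in `{E < (n+1)/β}`
  have hstep2 : ∀ n : ℕ,
      ((Finset.univ.filter fun k : TorusSite 2 L => nk k = n).card : ℝ) ≤
        C₀ * ((L : ℝ) * ((n + 1) / β) + 1) ^ 2 / Δ := by
    intro n
    have ht : (0 : ℝ) < (n + 1) / β := by positivity
    refine le_trans ?_ (hcard μ hμ Δ hΔ ((n + 1) / β) ht L)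
    have hsub : (Finset.univ.filter fun k : TorusSite 2 L => nk k = n) ⊆
        (Finset.univ.filter fun k : TorusSite 2 L =>
          (torusBand L k - μ) ^ 2 + (Δ * dWaveGap k) ^ 2 < ((n + 1) / β) ^ 2) := by
      intro k hk
      rw [Finset.mem_filter] at hk ⊢
      refine ⟨hk.1, ?_⟩
      have hlt : β * E k < n + 1 := by
        have := Nat.lt_floor_add_one (β * E k)
        rw [hnk] at hk
        simp only at hk
        rw [hk.2] at this
        exact_mod_cast this
      have hElt : E k < (n + 1) / β := by
        rw [lt_div_iff₀ hβ]; linarith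
      have := (Real.sqrt_lt' ht).1 hElt
      exact this
    exact_mod_cast Finset.card_le_card hsub
  -- step 3: regroup the sum by the value of `nk`
  set T : Finset ℕ := Finset.univ.image nk with hT
  have hregroup : ∑ k : TorusSite 2 L, Real.exp (-(nk k : ℝ)) =
      ∑ n ∈ T, Real.exp (-(n : ℝ)) * ((Finset.univ.filter fun k : TorusSite 2 L => nk k = n).card : ℝ) := by
    rw [← Finset.sum_fiberwise_of_maps_to (s := Finset.univ) (t := T) (g := nk)
      (fun k _ => Finset.mem_image_of_mem nk (Finset.mem_univ k))]
    refine Finset.sum_congr rfl fun n _ => ?_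
    rw [Finset.sum_congr rfl (g := fun _ => Real.exp (-(n : ℝ))) fun k hk => by
      rw [Finset.mem_filter] at hk; rw [hk.2]]
    rw [Finset.sum_const, nsmul_eq_mul, mul_comm]
  -- step 4: the termwise majorant
  have hterm : ∀ n ∈ T, Real.exp (-(n : ℝ)) * ((Finset.univ.filter fun k : TorusSite 2 L => nk k = n).card : ℝ) ≤
      8 * C₀ * ((L : ℝ) ^ 2 / β ^ 2 + 1) / Δ * q ^ n := by
    intro n _
    have h1 := hstep2 n
    have hexp0 : 0 ≤ Real.exp (-(n : ℝ)) := (Real.exp_pos _).le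
    have hmaj := exp_neg_mul_sq_add_one_le n
    -- `e^{-n} ≤ 4 qⁿ` as well
    have hexpq : Real.exp (-(n : ℝ)) ≤ 4 * q ^ n := by
      have h1le : (1 : ℝ) ≤ ((n : ℝ) + 1) ^ 2 := by
        have : (1 : ℝ) ≤ (n : ℝ) + 1 := by
          have := Nat.cast_nonneg (α := ℝ) n; linarith
        nlinarith
      calc Real.exp (-(n : ℝ)) = Real.exp (-(n : ℝ)) * 1 := (mul_one _).symm
        _ ≤ Real.exp (-(n : ℝ)) * ((n : ℝ) + 1) ^ 2 := mul_le_mul_of_nonneg_left h1le hexp0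
        _ ≤ 4 * q ^ n := hmaj
    -- `(L(n+1)/β + 1)² ≤ 2 L²(n+1)²/β² + 2`
    have hsq : ((L : ℝ) * ((n + 1) / β) + 1) ^ 2 ≤ 2 * ((L : ℝ) ^ 2 / β ^ 2) * ((n : ℝ) + 1) ^ 2 + 2 := by
      have e : (L : ℝ) * ((n + 1) / β) = (L : ℝ) / β * ((n : ℝ) + 1) := by ring
      have e2 : (L : ℝ) ^ 2 / β ^ 2 * ((n : ℝ) + 1) ^ 2 = ((L : ℝ) / β * ((n : ℝ) + 1)) ^ 2 := by
        rw [mul_pow, div_pow]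
      rw [e, mul_assoc, e2]
      nlinarith [sq_nonneg ((L : ℝ) / β * ((n : ℝ) + 1) - 1)]
    calc Real.exp (-(n : ℝ)) * ((Finset.univ.filter fun k : TorusSite 2 L => nk k = n).card : ℝ)
        ≤ Real.exp (-(n : ℝ)) * (C₀ * ((L : ℝ) * ((n + 1) / β) + 1) ^ 2 / Δ) :=
          mul_le_mul_of_nonneg_left h1 hexp0
      _ ≤ Real.exp (-(n : ℝ)) * (C₀ * (2 * ((L : ℝ) ^ 2 / β ^ 2) * ((n : ℝ) + 1) ^ 2 + 2) / Δ) := by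
          gcongr
      _ = 2 * C₀ / Δ * (((L : ℝ) ^ 2 / β ^ 2) * (Real.exp (-(n : ℝ)) * ((n : ℝ) + 1) ^ 2) +
            Real.exp (-(n : ℝ))) := by
          field_simp
      _ ≤ 2 * C₀ / Δ * (((L : ℝ) ^ 2 / β ^ 2) * (4 * q ^ n) + 4 * q ^ n) := by
          gcongr
      _ = 8 * C₀ * ((L : ℝ) ^ 2 / β ^ 2 + 1) / Δ * q ^ n := by
          field_simp
          ring
  -- assemble
  calc ∑ k : TorusSite 2 L, Real.exp (-(β * Real.sqrt ((torusBand L k - μ) ^ 2 + (Δ * dWaveGap k) ^ 2)))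
      = ∑ k : TorusSite 2 L, Real.exp (-(β * E k)) := rfl
    _ ≤ ∑ k : TorusSite 2 L, Real.exp (-(nk k : ℝ)) := Finset.sum_le_sum fun k _ => hstep1 k
    _ = ∑ n ∈ T, Real.exp (-(n : ℝ)) * ((Finset.univ.filter fun k : TorusSite 2 L => nk k = n).card : ℝ) :=
        hregroup
    _ ≤ ∑ n ∈ T, 8 * C₀ * ((L : ℝ) ^ 2 / β ^ 2 + 1) / Δ * q ^ n := Finset.sum_le_sum hterm
    _ = 8 * C₀ * ((L : ℝ) ^ 2 / β ^ 2 + 1) / Δ * ∑ n ∈ T, q ^ n := by rw [Finset.mul_sum]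
    _ ≤ 8 * C₀ * ((L : ℝ) ^ 2 / β ^ 2 + 1) / Δ * (1 - q)⁻¹ := by
        refine mul_le_mul_of_nonneg_left ?_ (by positivity)
        rw [← hqt]
        exact hqs.sum_le_tsum T (fun n _ => pow_nonneg hq0 n)
    _ = 8 * C₀ * (1 - q)⁻¹ * ((L : ℝ) ^ 2 / β ^ 2 + 1) / Δ := by ring

end Literature.MathematicalPhysics.QuantumLattice

end
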